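import Summits.AtomisticToContinuum.Crystallization.Theorems.ChessboardParticlePlanesPeriodicWindowsEnvelopeTail3

/-!
# Envelope numerics for `PeriodicWindows` (stmt-AtomisticToContinuum-3240), stub E2b — soundness of the integer evaluator

Soundness of `envFloorSum` (defined in `…EnvelopeDefs`), cloned from `…ExcessDecayLiouvilleCoarseGrainsPinEval`:
at a rational `t = a/b` the admissible term is `(3b)ᵉ / N_vᵉ` with the positive integer
`N_v = b·(3 Q_d) + 3 a k²`, the structural loops are `Finset.range` sums re-indexing the box
`envBox lo nk K`, and `⌊M/Nᵉ⌋ ≤ M/Nᵉ < ⌊M/Nᵉ⌋ + 1`; hence the CERTIFIED BOUNDS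
`(3b)ᵉ·FS/M ≤ envSum` (`envSum_ge_cert`) and `envSum ≤ (3b)ᵉ·(FS + nk(2K+1)²)/M + tail`
(`envSum_le_cert2` with `envTail2`, `envSum_le_cert3` with `envTail3`).  [folklore]
-/

noncomputable section

namespace Summit.AtomisticToContinuum.Crystallization.Theorems.PeriodicWindowsSketch

open Finset Summit.AtomisticToContinuum.Crystallization.Theorems.ExcessDecayLiouvilleCoarseGrains

/-! ## The numerator -/

/-- The integer numerator is `3b·Q_d + 3a k²` (`d ∈ {0,1}`). [folklore] -/
theorem envNumZ_cast (a b : ℕ) {d : ℕ} (hd : d = 0 ∨ d = 1) (k i j : ℤ) :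
    (envNumZ a b d k i j : ℝ) = 3 * (b : ℝ) * hcpSumQ ((d : ℤ), i, j) + 3 * (a : ℝ) * (k : ℝ) ^ 2 := by
  unfold envNumZ
  rcases hd with rfl | rfl
  · rw [if_pos rfl, Nat.cast_zero, hcpSumQ_even (show Even (0 : ℤ) from ⟨0, rfl⟩)]; push_cast; ring
  · rw [if_neg one_ne_zero, Nat.cast_one, hcpSumQ_odd (by decide)]; push_cast; ring

/-- For `t = a/b`: `Q_d + k² t = N / (3b)`. [folklore] -/
theorem env_r_eq (a : ℕ) {b : ℕ} (hb : 0 < b) {d : ℕ} (hd : d = 0 ∨ d = 1) (k i j : ℤ) :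
    hcpSumQ ((d : ℤ), i, j) + (k : ℝ) ^ 2 * ((a : ℝ) / b) = (envNumZ a b d k i j : ℝ) / (3 * (b : ℝ)) := by
  have hb' : (b : ℝ) ≠ 0 := by positivity
  rw [envNumZ_cast a b hd]
  field_simp

/-- The numerator is positive off the origin (`a, b > 0`). [folklore] -/
theorem envNumZ_pos {a b : ℕ} (ha : 0 < a) (hb : 0 < b) {d : ℕ} (hd : d = 0 ∨ d = 1) {k i j : ℤ}
    (hv : ((k, i, j) : ℤ × ℤ × ℤ) ≠ 0) : 0 < envNumZ a b d k i j := by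
  have h := env_r_pos hd hv (t := (a : ℝ) / b) (by positivity)
  rw [env_r_eq a hb hd] at h
  have h3 : (0 : ℝ) < 3 * (b : ℝ) := by positivity
  have h' : (0 : ℝ) < (envNumZ a b d k i j : ℝ) := by
    by_contra hcon
    push Not at hcon
    have := div_nonpos_of_nonpos_of_nonneg hcon h3.le
    linarith
  exact_mod_cast h'

/-- In the box the admissibility test reduces to `v ≠ 0` (one layer if `bdd`). [folklore] -/
theorem env_adm_iff_of_mem_envBox {lo nk K : ℕ} {bdd : Bool} (hbdd : bdd = true → nk = 1)
    {v : ℤ × ℤ × ℤ} (hv : v ∈ envBox lo nk K) :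
    ((lo : ℤ) ≤ v.1 ∧ (bdd = true → v.1 ≤ lo) ∧ v ≠ 0) ↔ v ≠ 0 := by
  rw [env_mem_envBox] at hv
  constructor
  · exact fun h => h.2.2
  · intro h0
    refine ⟨hv.1.1, fun hb => ?_, h0⟩
    have := hbdd hb
    subst this
    have := hv.1.2
    push_cast at this
    omega

/-- The box sum of the terms at `t = a/b` in terms of the numerators. [folklore] -/
theorem env_sum_envBox_envTerm_eq (a : ℕ) {b : ℕ} (hb : 0 < b) {d : ℕ} (hd : d = 0 ∨ d = 1) (lo : ℕ)
    {bdd : Bool} {nk : ℕ} (hbdd : bdd = true → nk = 1) (e K : ℕ) :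
    ∑ v ∈ envBox lo nk K, envTerm d lo bdd e ((a : ℝ) / b) v =
      (3 * (b : ℝ)) ^ e *
        ∑ v ∈ envBox lo nk K, (if v = 0 then 0 else (((envNumZ a b d v.1 v.2.1 v.2.2 : ℝ))⁻¹) ^ e) := by
  rw [Finset.mul_sum]
  refine Finset.sum_congr rfl fun v hv => ?_
  obtain ⟨k, i, j⟩ := v
  by_cases h0 : ((k, i, j) : ℤ × ℤ × ℤ) = 0
  · rw [if_pos h0, mul_zero]
    exact envTerm_of_not fun h => h.2.2 h0
  · rw [if_neg h0, envTerm_of ((env_adm_iff_of_mem_envBox hbdd hv).2 h0)]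
    dsimp only
    rw [env_r_eq a hb hd, inv_div, div_eq_mul_inv, mul_pow]

/-! ## Floor terms -/

/-- Upper floor bound for one term. [folklore] -/
theorem envFloorTerm_le {a b : ℕ} (ha : 0 < a) (hb : 0 < b) {d : ℕ} (hd : d = 0 ∨ d = 1) (k K e M ii jj : ℕ) :
    (envFloorTerm a b d k K e M ii jj : ℝ) ≤
      M * (if (((k : ℕ) : ℤ), (ii : ℤ) - K, (jj : ℤ) - K) = (0 : ℤ × ℤ × ℤ) then 0
        else (((envNumZ a b d k ((ii : ℤ) - K) ((jj : ℤ) - K) : ℝ))⁻¹) ^ e) := by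
  unfold envFloorTerm
  by_cases h0 : k = 0 ∧ ii = K ∧ jj = K
  · rw [if_pos h0]
    obtain ⟨rfl, rfl, rfl⟩ := h0
    simp
  · rw [if_neg h0]
    have hv : ((((k : ℕ) : ℤ), (ii : ℤ) - K, (jj : ℤ) - K) : ℤ × ℤ × ℤ) ≠ 0 := by
      intro h
      simp only [Prod.mk_eq_zero, sub_eq_zero] at h
      omega
    rw [if_neg hv]
    have hN := envNumZ_pos ha hb hd hv
    set N := envNumZ a b d k ((ii : ℤ) - K) ((jj : ℤ) - K) with hNdef
    have hNc : ((N.toNat : ℕ) : ℝ) = (N : ℝ) := by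
      have : ((N.toNat : ℕ) : ℤ) = N := Int.toNat_of_nonneg hN.le
      exact_mod_cast this
    calc ((M / N.toNat ^ e : ℕ) : ℝ) ≤ (M : ℝ) / ((N.toNat ^ e : ℕ) : ℝ) := Nat.cast_div_le
      _ = M * ((N : ℝ)⁻¹) ^ e := by rw [Nat.cast_pow, hNc, inv_pow, div_eq_mul_inv]

/-- Lower floor bound for one term. [folklore] -/
theorem env_le_envFloorTerm_add_one {a b : ℕ} (ha : 0 < a) (hb : 0 < b) {d : ℕ} (hd : d = 0 ∨ d = 1)
    (k K e M ii jj : ℕ) :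
    M * (if (((k : ℕ) : ℤ), (ii : ℤ) - K, (jj : ℤ) - K) = (0 : ℤ × ℤ × ℤ) then 0
        else (((envNumZ a b d k ((ii : ℤ) - K) ((jj : ℤ) - K) : ℝ))⁻¹) ^ e) ≤
      (envFloorTerm a b d k K e M ii jj : ℝ) + 1 := by
  unfold envFloorTerm
  by_cases h0 : k = 0 ∧ ii = K ∧ jj = K
  · rw [if_pos h0]
    obtain ⟨rfl, rfl, rfl⟩ := h0
    simp
  · rw [if_neg h0]
    have hv : ((((k : ℕ) : ℤ), (ii : ℤ) - K, (jj : ℤ) - K) : ℤ × ℤ × ℤ) ≠ 0 := by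
      intro h
      simp only [Prod.mk_eq_zero, sub_eq_zero] at h
      omega
    rw [if_neg hv]
    have hN := envNumZ_pos ha hb hd hv
    set N := envNumZ a b d k ((ii : ℤ) - K) ((jj : ℤ) - K) with hNdef
    have hNc : ((N.toNat : ℕ) : ℝ) = (N : ℝ) := by
      have : ((N.toNat : ℕ) : ℤ) = N := Int.toNat_of_nonneg hN.le
      exact_mod_cast this
    have hNpos : (0 : ℝ) < (N : ℝ) := by exact_mod_cast hN
    set q : ℕ := N.toNat ^ e with hqdef
    have hqc : (q : ℝ) = (N : ℝ) ^ e := by rw [hqdef, Nat.cast_pow, hNc]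
    have hqpos : (0 : ℝ) < q := by rw [hqc]; positivity
    have hdiv := Nat.div_add_mod M q
    have hmod := Nat.mod_lt M (show 0 < q by exact_mod_cast hqpos)
    have hreal : (M : ℝ) < (q : ℝ) * ((M / q : ℕ) : ℝ) + q := by
      have : (M : ℝ) = (q : ℝ) * ((M / q : ℕ) : ℝ) + ((M % q : ℕ) : ℝ) := by exact_mod_cast hdiv.symm
      have h2 : ((M % q : ℕ) : ℝ) < q := by exact_mod_cast hmod
      linarith
    have key : (M : ℝ) * ((N : ℝ)⁻¹) ^ e = (M : ℝ) / q := by rw [hqc, inv_pow, div_eq_mul_inv]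
    rw [key, div_le_iff₀ hqpos]
    nlinarith

/-! ## The loops -/

/-- The inner loop is a `Finset.range` sum. [folklore] -/
theorem envLoopJ_eq (a b d k K e M ii n : ℕ) :
    envLoopJ a b d k K e M ii n = ∑ jj ∈ Finset.range n, envFloorTerm a b d k K e M ii jj := by
  induction n with
  | zero => rfl
  | succ n ih => rw [envLoopJ, ih, Finset.sum_range_succ]

/-- The middle loop is a `Finset.range` sum. [folklore] -/
theorem envLoopI_eq (a b d k K e M n : ℕ) :
    envLoopI a b d k K e M n =
      ∑ ii ∈ Finset.range n, ∑ jj ∈ Finset.range (2 * K + 1), envFloorTerm a b d k K e M ii jj := by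
  induction n with
  | zero => rfl
  | succ n ih => rw [envLoopI, ih, Finset.sum_range_succ, envLoopJ_eq]

/-- The outer loop is a `Finset.range` sum over the layers `lo + kk`. [folklore] -/
theorem envLoopK_eq (a b d lo K e M n : ℕ) :
    envLoopK a b d lo K e M n = ∑ kk ∈ Finset.range n, ∑ ii ∈ Finset.range (2 * K + 1),
      ∑ jj ∈ Finset.range (2 * K + 1), envFloorTerm a b d (lo + kk) K e M ii jj := by
  induction n with
  | zero => rfl
  | succ n ih => rw [envLoopK, ih, Finset.sum_range_succ, envLoopI_eq]

/-- The floor sum as a triple `Finset.range` sum. [folklore] -/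
theorem envFloorSum_eq (a b d lo nk K e M : ℕ) :
    envFloorSum a b d lo nk K e M = ∑ kk ∈ Finset.range nk, ∑ ii ∈ Finset.range (2 * K + 1),
      ∑ jj ∈ Finset.range (2 * K + 1), envFloorTerm a b d (lo + kk) K e M ii jj :=
  envLoopK_eq a b d lo K e M nk

/-- **Reindexing the box sum** by the shifted natural indices. [folklore] -/
theorem env_sum_envBox_eq_sum_range (lo nk K : ℕ) (F : ℤ × ℤ × ℤ → ℝ) :
    ∑ v ∈ envBox lo nk K, F v = ∑ kk ∈ Finset.range nk, ∑ ii ∈ Finset.range (2 * K + 1),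
      ∑ jj ∈ Finset.range (2 * K + 1), F (((lo + kk : ℕ) : ℤ), (ii : ℤ) - K, (jj : ℤ) - K) := by
  unfold envBox
  rw [Finset.sum_product, Finset.sum_image (fun x _ y _ h => by simpa using h)]
  refine Finset.sum_congr rfl fun kk _ => ?_
  rw [Finset.sum_product, hcpSum_sum_Icc_eq_sum_range]
  refine Finset.sum_congr rfl fun ii _ => ?_
  rw [hcpSum_sum_Icc_eq_sum_range]

/-- **Floor sum, upper soundness**: `FS ≤ M · ∑_{box} [v ≠ 0] N_v^{-e}`. [folklore] -/
theorem envFloorSum_le {a b : ℕ} (ha : 0 < a) (hb : 0 < b) {d : ℕ} (hd : d = 0 ∨ d = 1) (lo nk K e M : ℕ) :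
    (envFloorSum a b d lo nk K e M : ℝ) ≤
      M * ∑ v ∈ envBox lo nk K, (if v = 0 then 0 else (((envNumZ a b d v.1 v.2.1 v.2.2 : ℝ))⁻¹) ^ e) := by
  rw [envFloorSum_eq, env_sum_envBox_eq_sum_range, Finset.mul_sum]
  push_cast
  refine Finset.sum_le_sum fun kk _ => ?_
  rw [Finset.mul_sum]
  refine Finset.sum_le_sum fun ii _ => ?_
  rw [Finset.mul_sum]
  refine Finset.sum_le_sum fun jj _ => ?_
  exact envFloorTerm_le ha hb hd (lo + kk) K e M ii jj

/-- **Floor sum, lower soundness**: `M · ∑_{box} [v ≠ 0] N_v^{-e} ≤ FS + nk(2K+1)²`. [folklore] -/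
theorem env_le_envFloorSum_add {a b : ℕ} (ha : 0 < a) (hb : 0 < b) {d : ℕ} (hd : d = 0 ∨ d = 1)
    (lo nk K e M : ℕ) :
    M * ∑ v ∈ envBox lo nk K, (if v = 0 then 0 else (((envNumZ a b d v.1 v.2.1 v.2.2 : ℝ))⁻¹) ^ e) ≤
      (envFloorSum a b d lo nk K e M : ℝ) + nk * (2 * K + 1) ^ 2 := by
  have hcount : (nk : ℝ) * (2 * (K : ℝ) + 1) ^ 2 = ∑ _kk ∈ Finset.range nk,
      ∑ _ii ∈ Finset.range (2 * K + 1), ∑ _jj ∈ Finset.range (2 * K + 1), (1 : ℝ) := by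
    simp only [Finset.sum_const, Finset.card_range, nsmul_eq_mul, mul_one]
    push_cast
    ring
  rw [envFloorSum_eq, env_sum_envBox_eq_sum_range, Finset.mul_sum]
  push_cast
  rw [hcount, ← Finset.sum_add_distrib]
  refine Finset.sum_le_sum fun kk _ => ?_
  rw [Finset.mul_sum, ← Finset.sum_add_distrib]
  refine Finset.sum_le_sum fun ii _ => ?_
  rw [Finset.mul_sum, ← Finset.sum_add_distrib]
  refine Finset.sum_le_sum fun jj _ => ?_
  exact env_le_envFloorTerm_add_one ha hb hd (lo + kk) K e M ii jj

/-! ## Certified bounds -/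

/-- **Certified lower bound**: `(3b)ᵉ · FS / M ≤ envSum d lo bdd e (a/b)` (one layer if `bdd`).
[folklore] -/
theorem envSum_ge_cert {e : ℕ} (he : 3 ≤ e) {a b : ℕ} (ha : 0 < a) (hb : 0 < b) {d : ℕ} (hd : d = 0 ∨ d = 1)
    (lo : ℕ) {bdd : Bool} {nk : ℕ} (hbdd : bdd = true → nk = 1) (K : ℕ) {M : ℕ} (hM : 0 < M) :
    (3 * (b : ℝ)) ^ e * (envFloorSum a b d lo nk K e M : ℝ) / M ≤ envSum d lo bdd e ((a : ℝ) / b) := by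
  refine le_trans ?_ (env_box_le_envSum d lo bdd he (by positivity) nk K)
  rw [env_sum_envBox_envTerm_eq a hb hd lo hbdd, mul_div_assoc]
  refine mul_le_mul_of_nonneg_left ?_ (by positivity)
  rw [div_le_iff₀ (by exact_mod_cast hM)]
  have := envFloorSum_le ha hb hd lo nk K e M
  linarith

/-- **Certified upper bound, one-layer pattern**:
`envSum d lo true e (a/b) ≤ (3b)ᵉ (FS + (2K+1)²)/M + envTail2 e K`. [folklore] -/
theorem envSum_le_cert2 {e : ℕ} (he : 3 ≤ e) {a b : ℕ} (ha : 0 < a) (hb : 0 < b) {d : ℕ} (hd : d = 0 ∨ d = 1)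
    (lo : ℕ) {K : ℕ} (hK : 4 ≤ K) {M : ℕ} (hM : 0 < M) :
    envSum d lo true e ((a : ℝ) / b) ≤
      (3 * (b : ℝ)) ^ e * ((envFloorSum a b d lo 1 K e M : ℝ) + (2 * K + 1) ^ 2) / M + envTail2 e K := by
  refine le_trans (envSum_le_box_add_tail2 d lo he (by positivity) hK) ?_
  rw [env_sum_envBox_envTerm_eq a hb hd lo (fun _ => rfl)]
  refine add_le_add_left ?_ (envTail2 e K)
  rw [mul_div_assoc]
  refine mul_le_mul_of_nonneg_left ?_ (by positivity)
  rw [le_div_iff₀ (by exact_mod_cast hM)]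
  have := env_le_envFloorSum_add ha hb hd lo 1 K e M
  push_cast at this
  linarith

/-- **Certified upper bound, unbounded pattern**:
`envSum d lo false e (a/b) ≤ (3b)ᵉ (FS + nk(2K+1)²)/M + envTail3 r α e K`. [folklore] -/
theorem envSum_le_cert3 {e : ℕ} (he : 3 ≤ e) {a b : ℕ} (ha : 0 < a) (hb : 0 < b) {d : ℕ} (hd : d = 0 ∨ d = 1)
    (lo : ℕ) {α : ℝ} (hα : 0 < α) (hα' : α ≤ 3 / 5) {r K nk : ℕ} (hr : 1 ≤ r) (hK : 4 ≤ K)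
    (hcond : α * ((K : ℝ) + 1) ^ 2 ≤ ((r : ℝ) * K + 1) ^ 2 * ((a : ℝ) / b)) (hnk : r * K + 1 ≤ lo + nk)
    {M : ℕ} (hM : 0 < M) :
    envSum d lo false e ((a : ℝ) / b) ≤
      (3 * (b : ℝ)) ^ e * ((envFloorSum a b d lo nk K e M : ℝ) + nk * (2 * K + 1) ^ 2) / M + envTail3 r α e K := by
  refine le_trans (envSum_le_box_add_tail3 d lo he (by positivity) hα hα' hr hK hcond hnk) ?_
  rw [env_sum_envBox_envTerm_eq a hb hd lo (bdd := false) (nk := nk) (fun h => Bool.noConfusion h)]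
  refine add_le_add_left ?_ (envTail3 r α e K)
  rw [mul_div_assoc]
  refine mul_le_mul_of_nonneg_left ?_ (by positivity)
  rw [le_div_iff₀ (by exact_mod_cast hM)]
  have := env_le_envFloorSum_add ha hb hd lo nk K e M
  linarith

end Summit.AtomisticToContinuum.Crystallization.Theorems.PeriodicWindowsSketch

end
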